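import Summits.ResolutionOfSingularities.ResolutionOfSingularities.Theorems.FrobeniusLadderFRationalResolutionSingularPointsFinite
import Summits.ResolutionOfSingularities.ResolutionOfSingularities.Theorems.FrobeniusLadderFRationalResolutionTraceIdealDivisorial
import Literature.AlgebraicGeometry.Resolution.ArithmeticalThreefoldsBlowupFormProofs
import HarnessLib

/-!
# Crux `FrobeniusLadder.FRationalResolution` (stmt-ResolutionOfSingularities-15317), line `redirect`,
# stub `stub_diagonalizableQuotientResolution` — THE CLASS-GROUP CENTRE RECIPE WITH ITS ALGEBRAIC SLOTS DISCHARGED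

`…IntrinsicRecipe.hloc_of_traceIdealCentre_then_singularPoints` (p839630) settles a twisted isolated point from: Galois data, the finiteness of the
set `𝒯` of trace ideals of nonzero divisorial ideals of `Ê`, an exponent `N`, the inclusions `(𝔔'Ê)ⁿ ⊆ 𝔞_totᴺ ≠ ⊤` (`𝔞_tot = ∏_{T ∈ 𝒯} T`), the hygiene
«`Sing Bl_{𝔞_totᴺ}` closed, of closed points», and the local resolvability `hloc` of the singular points. With
`…TraceIdealDivisorial` (p840118: `𝔪̂ⁿ ⊆ τ(I)` for nonzero divisorial `I` when the punctured spectrum of `Ê` is regular — which it is, p839565),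
`…TraceIdealPrimary` (p840068: `τ(I₀) ≠ ⊤` for a non-principal `I₀`) and `…SingularPointsFinite` (p840034: finiteness of the singular locus suffices)
the statement shrinks to:

★★★ `hloc_of_traceIdealCentre_then_finite_singularPoints` — Galois data + `Ê` a domain + `𝒯` finite + ONE non-principal nonzero divisorial ideal
`I₀` + `N ≠ 0` + `Sing Bl_{𝔞_totᴺ}(Spec Ê)` FINITE with `Bl_{𝔪_z}(Spec 𝒪_z)` regular at each of its points ⇒ `hloc` at the twisted point.

What remains class-specific: `𝒯` finite (⟸ a finite list of divisorial representatives, p839695) and the fan facts. Honest label: assembly toward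
ONE leaf stub (no stub, crux or summit closed). No definitions, no named facts, no sorry.
[cite: StacksProject, Tag 080B; Tag 0CDQ; Tag 09EB] [cite: Matsumura1987, Thm. 20.3; §11; Thm. 8.14]
-/

noncomputable section

-- single-problem summit: the doubled namespace component is forced
set_option linter.dupNamespace false

open CategoryTheory AlgebraicGeometry TopologicalSpace IsLocalRing TensorProduct
open Literature.AlgebraicGeometry.Resolution
open Summit.ResolutionOfSingularities.ResolutionOfSingularities.Theorems.FRationalResolution

namespace Summit.ResolutionOfSingularities.ResolutionOfSingularities.Theorems.FRationalResolution.IntrinsicRecipeFinite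

/-- **Off the closed point, the local rings of `Ê` are regular** (ring form of p839565's `mem_regularLocus_Spec_adicCompletion_galois`).
[cite: Matsumura1987, Thm. 23.7; §32] -/
theorem isRegularLocalRing_localization_adicCompletion_galois (K : Type) [Field K] {B : Type} [CommRing B] [Algebra K B]
    [Algebra.FiniteType K B] (𝔭 : Ideal B) [h𝔭 : 𝔭.IsMaximal]
    (hregB : ∀ P : Spec (.of B), P.asIdeal ≠ 𝔭 → P ∈ Scheme.regularLocus (Spec (.of B)))
    (K' : Type) [Field K'] [Algebra K K'] [FiniteDimensional K K'] [IsGalois K K']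
    (𝔔' : Ideal (B ⊗[K] K')) [h𝔔' : 𝔔'.IsMaximal]
    (𝔮 : Ideal (AdicCompletion (maximalIdeal (Localization.AtPrime 𝔔')) (Localization.AtPrime 𝔔'))) [h𝔮 : 𝔮.IsPrime]
    (hQ : ¬ 𝔔'.map (algebraMap (B ⊗[K] K') (AdicCompletion (maximalIdeal (Localization.AtPrime 𝔔')) (Localization.AtPrime 𝔔'))) ≤ 𝔮) :
    IsRegularLocalRing (Localization.AtPrime 𝔮) := by
  have h := SingularPointsOverVertex.mem_regularLocus_Spec_adicCompletion_galois K 𝔭 hregB K' 𝔔' ⟨𝔮, h𝔮⟩ hQ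
  rw [regularLocus_Spec_eq] at h
  exact h

/-- ★★★ **THE CLASS-GROUP CENTRE, THEN FINITELY MANY SINGULAR POINTS** — `…IntrinsicRecipe.hloc_of_traceIdealCentre_then_singularPoints` with the slots
`(𝔔'Ê)ⁿ ⊆ 𝔞_totᴺ` (p840118), `𝔞_totᴺ ≠ ⊤` (p840068) and «`Sing` closed, of closed points» (p840034) discharged. Inputs: `Ê` a domain, `𝒯` finite, one
non-principal nonzero divisorial ideal `I₀`, `N ≠ 0`, `Sing Bl_{𝔞_totᴺ}(Spec Ê)` finite and resolved pointwise by `Bl_{𝔪_z}`.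
[cite: StacksProject, Tag 080B; Tag 0CDQ; Tag 09EB] [cite: Matsumura1987, Thm. 20.3; §11; Thm. 8.11; Thm. 8.14] -/
theorem hloc_of_traceIdealCentre_then_finite_singularPoints (K : Type) [Field K] (X : Scheme.{0}) [IsIntegral X]
    (f : X ⟶ Spec (.of K)) [LocallyOfFiniteType f]
    {B : Type} [CommRing B] [IsDomain B] [Algebra K B] [Algebra.FiniteType K B]
    (ι : Spec (.of B) ⟶ X) [IsOpenImmersion ι] (hι : ι ≫ f = Spec.map (CommRingCat.ofHom (algebraMap K B)))
    (𝔭 : Ideal B) [h𝔭 : 𝔭.IsMaximal] (h𝔭0 : 𝔭 ≠ ⊥)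
    (hsing : ι ⟨𝔭, h𝔭.isPrime⟩ ∉ Scheme.regularLocus X)
    (hregB : ∀ P : Spec (.of B), P.asIdeal ≠ 𝔭 → P ∈ Scheme.regularLocus (Spec (.of B)))
    (K' : Type) [Field K'] [Algebra K K'] [FiniteDimensional K K'] [IsGalois K K']
    (𝔔' : Ideal (B ⊗[K] K')) [h𝔔' : 𝔔'.IsMaximal] (h𝔔'𝔭 : 𝔔'.comap (algebraMap B (B ⊗[K] K')) = 𝔭)
    (hdom : IsDomain (AdicCompletion (maximalIdeal (Localization.AtPrime 𝔔')) (Localization.AtPrime 𝔔')))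
    (hfin : Set.Finite {T : Ideal (AdicCompletion (maximalIdeal (Localization.AtPrime 𝔔')) (Localization.AtPrime 𝔔')) |
      ∃ I : Ideal (AdicCompletion (maximalIdeal (Localization.AtPrime 𝔔')) (Localization.AtPrime 𝔔')),
        (I ≠ ⊥ ∧ ∀ x, (∀ a b, (∀ y ∈ I, b * y ∈ Ideal.span {a}) → b * x ∈ Ideal.span {a}) → x ∈ I) ∧
        T = ⨆ φ : I →ₗ[AdicCompletion (maximalIdeal (Localization.AtPrime 𝔔')) (Localization.AtPrime 𝔔')]
          AdicCompletion (maximalIdeal (Localization.AtPrime 𝔔')) (Localization.AtPrime 𝔔'), LinearMap.range φ})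
    (I₀ : Ideal (AdicCompletion (maximalIdeal (Localization.AtPrime 𝔔')) (Localization.AtPrime 𝔔')))
    (hI₀ : I₀ ≠ ⊥ ∧ ∀ x, (∀ a b, (∀ y ∈ I₀, b * y ∈ Ideal.span {a}) → b * x ∈ Ideal.span {a}) → x ∈ I₀)
    (hI₀np : ∀ x₀ ∈ I₀, I₀ ≠ Ideal.span {x₀})
    (N : ℕ) (hN : N ≠ 0)
    (hfinS : (Scheme.regularLocus (affineBlowup ((∏ T ∈ hfin.toFinset, T) ^ N)))ᶜ.Finite)
    (hloc : ∀ z ∈ (Scheme.regularLocus (affineBlowup ((∏ T ∈ hfin.toFinset, T) ^ N)))ᶜ,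
      Scheme.IsRegular (affineBlowup (maximalIdeal ((affineBlowup ((∏ T ∈ hfin.toFinset, T) ^ N)).presheaf.stalk z)))) :
    ∃ (V : X.Opens), ι ⟨𝔭, h𝔭.isPrime⟩ ∈ V ∧
      (∀ t : X, t ∉ Scheme.regularLocus X → t ∈ V → t = ι ⟨𝔭, h𝔭.isPrime⟩) ∧
      ∃ (Y : Scheme.{0}) (ρ : Y ⟶ V), IsProper ρ ∧ Scheme.IsRegular Y ∧
        IsIso (ρ ∣_ (V.ι ⁻¹ᵁ ⟨Scheme.regularLocus X, isOpen_regularLocus_of_locallyOfFiniteType_field f⟩)) ∧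
        Dense ((ρ ⁻¹ᵁ (V.ι ⁻¹ᵁ ⟨Scheme.regularLocus X,
          isOpen_regularLocus_of_locallyOfFiniteType_field f⟩) : Y.Opens) : Set Y) := by
  classical
  haveI : IsNoetherianRing B := Algebra.FiniteType.isNoetherianRing K B
  haveI : Algebra.FiniteType B (B ⊗[K] K') := inferInstance
  haveI : IsNoetherianRing (B ⊗[K] K') := Algebra.FiniteType.isNoetherianRing B (B ⊗[K] K')
  haveI : IsNoetherianRing (Localization.AtPrime 𝔔') :=
    IsLocalization.isNoetherianRing 𝔔'.primeCompl (Localization.AtPrime 𝔔') inferInstance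
  set Ê := AdicCompletion (maximalIdeal (Localization.AtPrime 𝔔')) (Localization.AtPrime 𝔔') with hÊ
  haveI : IsNoetherianRing Ê := isNoetherianRing_adicCompletion_maximalIdeal _
  haveI : IsDomain Ê := hdom
  have hfac : algebraMap (B ⊗[K] K') Ê =
      (algebraMap (Localization.AtPrime 𝔔') Ê).comp (algebraMap (B ⊗[K] K') (Localization.AtPrime 𝔔')) :=
    RingHom.ext fun _ => rfl
  have hmapQ : 𝔔'.map (algebraMap (B ⊗[K] K') Ê) = maximalIdeal Ê := by
    rw [hfac, ← Ideal.map_map, Localization.AtPrime.map_eq_maximalIdeal, ← AdicCompletion.maximalIdeal_eq_map]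
  -- the punctured spectrum of `Ê` is regular
  have hreg : ∀ (𝔮 : Ideal Ê) [𝔮.IsPrime], 𝔮 ≠ maximalIdeal Ê → IsRegularLocalRing (Localization.AtPrime 𝔮) := by
    intro 𝔮 h𝔮p h𝔮
    refine isRegularLocalRing_localization_adicCompletion_galois K 𝔭 hregB K' 𝔔' 𝔮 ?_
    rw [hmapQ]
    intro hle
    exact h𝔮 ((maximalIdeal.isMaximal Ê).eq_of_le h𝔮p.ne_top hle).symm
  -- every member of `𝒯` contains a power of `𝔪̂`
  have hT : ∀ T ∈ hfin.toFinset, ∃ n : ℕ, maximalIdeal Ê ^ n ≤ T := by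
    intro T hT
    obtain ⟨I, hI, rfl⟩ := hfin.mem_toFinset.mp hT
    exact TraceIdealDivisorial.exists_pow_maximalIdeal_le_traceIdeal_of_divisorial hreg I hI
  obtain ⟨m, hm⟩ := TraceIdealPrimary.exists_pow_le_prod (maximalIdeal Ê) hfin.toFinset hT
  have hn : 𝔔'.map (algebraMap (B ⊗[K] K') Ê) ^ (m * N) ≤ (∏ T ∈ hfin.toFinset, T) ^ N := by
    rw [hmapQ, pow_mul]
    exact Ideal.pow_right_mono hm N
  -- `𝔞_tot ≠ ⊤`: the non-principal class `I₀` contributes a proper factor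
  have hτI₀ : (⨆ φ : I₀ →ₗ[Ê] Ê, LinearMap.range φ : Ideal Ê) ∈ hfin.toFinset :=
    hfin.mem_toFinset.mpr ⟨I₀, hI₀, rfl⟩
  have h𝔞top : (∏ T ∈ hfin.toFinset, T) ≠ ⊤ :=
    TraceIdealPrimary.prod_ne_top_of_mem _ hτI₀ (TraceIdealPrimary.traceIdeal_le_maximalIdeal_of_not_principal I₀ hI₀np).1
  have htop : (∏ T ∈ hfin.toFinset, T) ^ N ≠ ⊤ :=
    ne_top_of_le_ne_top h𝔞top (Ideal.pow_le_self hN)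
  exact SingularPointsFinite.hloc_of_characteristic_then_finite_singularPoints K X f ι hι 𝔭 h𝔭0 hsing hregB K' 𝔔' h𝔔'𝔭 _ hn
    htop (DivisorialIdealsCharacteristic.forall_map_pow_prod_traceIdeal_divisorial_le hfin N) hfinS hloc

end Summit.ResolutionOfSingularities.ResolutionOfSingularities.Theorems.FRationalResolution.IntrinsicRecipeFinite

end
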